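import Mathlib
import Summits.Ventures.PercRepro.TriangleCapSevenElevenA

/-!
# PercRepro — towards the cell `(7, 11)`: two vertex-disjoint triangles with no outer vertex give
`Σ_{codeg = 0} deficit ≥ 6` (p3, gen 35; part 35h)

* `six_le_sum_codeg_zero` — three `codeg = 0` pairs `(r, t₁)`, `(r, t₂)`, `(p, s)` with `t₁ ≠ t₂` and
  `p, s ≠ r` (six distinct ordered pairs) and positive deficits give `Σ₀ ≥ 6`;
* **`six_le_of_disjoint_no_outer`** — two vertex-disjoint triangles `u v w`, `a b c` with every triangle vertex
  in `S` and no outer vertex for either: a vertex `r` off `S` has exactly one neighbour `t₁` in the first and `t₂`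
  in the second; the two other vertices `p, p′` of the first triangle have neighbours `s, s′` in the second,
  not both equal to `t₂` (a vertex off a triangle is adjacent to at most one of its vertices); for the one with
  `s ≠ t₂` the pair `(p, s)` has `codeg = 0` and `r` in its deficit; with `(r, t₁)` and `(r, t₂)` (each missing
  a vertex of the other triangle) this is `Σ₀ ≥ 6` — the `k = 7` need in the two-triangle case.

Axioms: standard.
-/

namespace PercRepro

namespace TriangleCap

namespace C047

open Finset

variable {V : Type*} [Fintype V] [DecidableEq V]

/-- Three `codeg = 0` pairs with positive deficits give `Σ_{codeg = 0} deficit ≥ 6`. -/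
theorem six_le_sum_codeg_zero (D : SimpleGraph V) [DecidableRel D.Adj] {r t₁ t₂ p s : V}
    (h12 : t₁ ≠ t₂) (hpr : p ≠ r) (hsr : s ≠ r) (hr1 : D.Adj r t₁) (hr2 : D.Adj r t₂) (hps : D.Adj p s)
    (hc1 : codeg D (r, t₁) = 0) (hc2 : codeg D (r, t₂) = 0) (hc3 : codeg D (p, s) = 0)
    (hd1 : 1 ≤ deficit D (r, t₁)) (hd2 : 1 ≤ deficit D (r, t₂)) (hd3 : 1 ≤ deficit D (p, s)) :
    6 ≤ ∑ q ∈ adjPairsAll D, (if codeg D q = 0 then deficit D q else 0) := by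
  set P : Finset (V × V) := {(r, t₁), (t₁, r), (r, t₂), (t₂, r), (p, s), (s, p)} with hP
  have hsub : P ⊆ adjPairsAll D := by
    intro q hq
    rw [hP] at hq
    simp only [mem_insert, mem_singleton] at hq
    rw [mem_adjPairsAll]
    rcases hq with rfl | rfl | rfl | rfl | rfl | rfl
    · exact hr1
    · exact hr1.symm
    · exact hr2
    · exact hr2.symm
    · exact hps
    · exact hps.symm
  have hc1' : codeg D (t₁, r) = 0 := by rw [codeg_comm]; exact hc1
  have hc2' : codeg D (t₂, r) = 0 := by rw [codeg_comm]; exact hc2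
  have hc3' : codeg D (s, p) = 0 := by rw [codeg_comm]; exact hc3
  have hd1' : 1 ≤ deficit D (t₁, r) := by rw [deficit_comm]; exact hd1
  have hd2' : 1 ≤ deficit D (t₂, r) := by rw [deficit_comm]; exact hd2
  have hd3' : 1 ≤ deficit D (s, p) := by rw [deficit_comm]; exact hd3
  have hpos : ∀ q ∈ P, 1 ≤ (if codeg D q = 0 then deficit D q else 0) := by
    intro q hq
    rw [hP] at hq
    simp only [mem_insert, mem_singleton] at hq
    rcases hq with rfl | rfl | rfl | rfl | rfl | rfl
    · rw [if_pos hc1]; exact hd1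
    · rw [if_pos hc1']; exact hd1'
    · rw [if_pos hc2]; exact hd2
    · rw [if_pos hc2']; exact hd2'
    · rw [if_pos hc3]; exact hd3
    · rw [if_pos hc3']; exact hd3'
  have hcard : P.card = 6 := by
    rw [hP, card_insert_of_notMem, card_insert_of_notMem, card_insert_of_notMem,
      card_insert_of_notMem, card_insert_of_notMem, card_singleton]
    all_goals simp [hr1.ne, hr2.ne, hps.ne, hr1.ne.symm, hr2.ne.symm, hps.ne.symm, h12,
      hpr.symm, hsr.symm]
  calc 6 = ∑ _q ∈ P, 1 := by rw [sum_const, hcard]; rfl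
    _ ≤ ∑ q ∈ P, (if codeg D q = 0 then deficit D q else 0) := sum_le_sum hpos
    _ ≤ ∑ q ∈ adjPairsAll D, (if codeg D q = 0 then deficit D q else 0) := sum_le_sum_of_subset hsub

/-- **TWO VERTEX-DISJOINT TRIANGLES, NO OUTER VERTEX:** `Σ_{codeg = 0} deficit ≥ 6` (`k ≥ 7`). -/
theorem six_le_of_disjoint_no_outer (D : SimpleGraph V) [DecidableRel D.Adj] (hK : K4mFree D)
    (hk : 7 ≤ Fintype.card V) {u v w a b c : V}
    (huv : D.Adj u v) (huw : D.Adj u w) (hvw : D.Adj v w) (hab : D.Adj a b) (hac : D.Adj a c)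
    (hbc : D.Adj b c) (ha : ¬ (a = u ∨ a = v ∨ a = w)) (hb : ¬ (b = u ∨ b = v ∨ b = w))
    (hc : ¬ (c = u ∨ c = v ∨ c = w))
    (hS : ∀ x y z, D.Adj x y → D.Adj x z → D.Adj y z → x = u ∨ x = v ∨ x = w ∨ x = a ∨ x = b ∨ x = c)
    (hO1 : outer D u v w = ∅) (hO2 : outer D a b c = ∅) :
    6 ≤ ∑ q ∈ adjPairsAll D, (if codeg D q = 0 then deficit D q else 0) := by
  -- a vertex of the second triangle is not in the first, and conversely
  have hT2T1 : ∀ y, (y = a ∨ y = b ∨ y = c) → ¬ (y = u ∨ y = v ∨ y = w) := by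
    rintro y (rfl | rfl | rfl)
    · exact ha
    · exact hb
    · exact hc
  have hT1T2 : ∀ y, (y = u ∨ y = v ∨ y = w) → ¬ (y = a ∨ y = b ∨ y = c) := fun y h1 h2 => hT2T1 y h2 h1
  obtain ⟨r, hr⟩ := exists_not_six hk u v w a b c
  have hr1 : ¬ (r = u ∨ r = v ∨ r = w) := fun h => hr (or6_of_or3_left h)
  have hr2 : ¬ (r = a ∨ r = b ∨ r = c) := fun h => hr (or6_of_or3_right h)
  have hno : ∀ x z, D.Adj r x → D.Adj r z → D.Adj x z → False :=
    fun x z h1 h2 h3 => hr (hS r x z h1 h2 h3)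
  have hrO1 : r ∉ outer D u v w := by rw [hO1]; exact notMem_empty r
  have hrO2 : r ∉ outer D a b c := by rw [hO2]; exact notMem_empty r
  -- the neighbour of `r` in the second triangle
  obtain ⟨t₂, ht₂, hrt₂⟩ : ∃ t₂, (t₂ = a ∨ t₂ = b ∨ t₂ = c) ∧ D.Adj r t₂ := by
    rcases adj_of_not_outer D hrO2 with h | h | h
    · exact ⟨a, by simp, h.symm⟩
    · exact ⟨b, by simp, h.symm⟩
    · exact ⟨c, by simp, h.symm⟩
  have ht₂1 : ¬ (t₂ = u ∨ t₂ = v ∨ t₂ = w) := hT2T1 t₂ ht₂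
  -- the generic step: `t₁` the neighbour of `r` in the first triangle, `p, p′` its other two vertices
  have inner : ∀ t₁ p p' : V, (t₁ = u ∨ t₁ = v ∨ t₁ = w) → (p = u ∨ p = v ∨ p = w) →
      (p' = u ∨ p' = v ∨ p' = w) → p ≠ p' → p ≠ t₁ → p' ≠ t₁ → D.Adj r t₁ →
      6 ≤ ∑ q ∈ adjPairsAll D, (if codeg D q = 0 then deficit D q else 0) := by
    intro t₁ p p' ht₁ hp hp' hpp' hpt hp't hrt₁
    have ht₁2 : ¬ (t₁ = a ∨ t₁ = b ∨ t₁ = c) := hT1T2 t₁ ht₁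
    have hp2 : ¬ (p = a ∨ p = b ∨ p = c) := hT1T2 p hp
    have hp'2 : ¬ (p' = a ∨ p' = b ∨ p' = c) := hT1T2 p' hp'
    have h12 : t₁ ≠ t₂ := fun h => ht₁2 (h ▸ ht₂)
    -- `r` has no second neighbour in the first triangle
    have hr_only1 : ∀ y, (y = u ∨ y = v ∨ y = w) → D.Adj r y → y = t₁ := by
      intro y hy hry
      by_contra hne
      exact not_adj_two_of_triangle D hK huv huw hvw hr1 hy ht₁ hne hry hrt₁
    have hr_only2 : ∀ y, (y = a ∨ y = b ∨ y = c) → D.Adj r y → y = t₂ := by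
      intro y hy hry
      by_contra hne
      exact not_adj_two_of_triangle D hK hab hac hbc hr2 hy ht₂ hne hry hrt₂
    -- the neighbours of `p`, `p′` in the second triangle
    have hnb : ∀ q, (q = u ∨ q = v ∨ q = w) → ∃ s, (s = a ∨ s = b ∨ s = c) ∧ D.Adj q s := by
      intro q hq
      have hqO : q ∉ outer D a b c := by rw [hO2]; exact notMem_empty q
      rcases adj_of_not_outer D hqO with h | h | h
      · exact ⟨a, by simp, h.symm⟩
      · exact ⟨b, by simp, h.symm⟩
      · exact ⟨c, by simp, h.symm⟩
    obtain ⟨s, hs, hps⟩ := hnb p hp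
    obtain ⟨s', hs', hp's⟩ := hnb p' hp'
    -- one of `s, s′` differs from `t₂`
    have hone : s ≠ t₂ ∨ s' ≠ t₂ := by
      by_contra hcon
      have hs2 : s = t₂ := by by_contra h; exact hcon (Or.inl h)
      have hs'2 : s' = t₂ := by by_contra h; exact hcon (Or.inr h)
      subst hs2; subst hs'2
      exact not_adj_two_of_triangle D hK huv huw hvw ht₂1 hp hp' hpp' hps.symm hp's.symm
    -- the far pair `(q, σ)`: `q` one of `p, p′`, `σ` its neighbour, `σ ≠ t₂`
    have far : ∀ q σ, (q = u ∨ q = v ∨ q = w) → (σ = a ∨ σ = b ∨ σ = c) → q ≠ t₁ → σ ≠ t₂ →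
        D.Adj q σ → 6 ≤ ∑ q ∈ adjPairsAll D, (if codeg D q = 0 then deficit D q else 0) := by
      intro q σ hq hσ hqt hσt hqσ
      have hq2 : ¬ (q = a ∨ q = b ∨ q = c) := hT1T2 q hq
      have hσ1 : ¬ (σ = u ∨ σ = v ∨ σ = w) := hT2T1 σ hσ
      have hrq : ¬ D.Adj r q := fun h => hqt (hr_only1 q hq h)
      have hrσ : ¬ D.Adj r σ := fun h => hσt (hr_only2 σ hσ h)
      have hqr : q ≠ r := fun h => hr1 (h ▸ hq)
      have hσr : σ ≠ r := fun h => hr2 (h ▸ hσ)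
      -- `(q, σ)` lies on no triangle
      have hc3 : codeg D (q, σ) = 0 := by
        unfold codeg
        rw [card_eq_zero, filter_eq_empty_iff]
        intro y _ hy
        have hyS := hS y q σ hy.1.symm hy.2.symm hqσ
        rcases hyS with h | h | h | h | h | h
        · exact not_adj_two_of_triangle D hK huv huw hvw hσ1 hq (by simp [h]) hy.1.ne hqσ.symm hy.2
        · exact not_adj_two_of_triangle D hK huv huw hvw hσ1 hq (by simp [h]) hy.1.ne hqσ.symm hy.2
        · exact not_adj_two_of_triangle D hK huv huw hvw hσ1 hq (by simp [h]) hy.1.ne hqσ.symm hy.2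
        · exact not_adj_two_of_triangle D hK hab hac hbc hq2 hσ (by simp [h]) hy.2.ne hqσ hy.1
        · exact not_adj_two_of_triangle D hK hab hac hbc hq2 hσ (by simp [h]) hy.2.ne hqσ hy.1
        · exact not_adj_two_of_triangle D hK hab hac hbc hq2 hσ (by simp [h]) hy.2.ne hqσ hy.1
      have hd3 : 1 ≤ deficit D (q, σ) :=
        one_le_deficit D (fun h => hrq h.symm) (fun h => hrσ h.symm)
      -- the pairs at `r`
      have hc1 : codeg D (r, t₁) = 0 := codeg_eq_zero_of_no_triangle D hrt₁ hno
      have hc2 : codeg D (r, t₂) = 0 := codeg_eq_zero_of_no_triangle D hrt₂ hno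
      have hd1 : 1 ≤ deficit D (r, t₁) := by
        obtain ⟨z, hz1, hz2⟩ := exists_nonadj_of_triangle D hK hab hac hbc hr2 ht₁2
        exact one_le_deficit D hz1 hz2
      have hd2 : 1 ≤ deficit D (r, t₂) := by
        obtain ⟨z, hz1, hz2⟩ := exists_nonadj_of_triangle D hK huv huw hvw hr1 ht₂1
        exact one_le_deficit D hz1 hz2
      exact six_le_sum_codeg_zero D h12 hqr hσr hrt₁ hrt₂ hqσ hc1 hc2 hc3 hd1 hd2 hd3
    rcases hone with h | h
    · exact far p s hp hs hpt h hps
    · exact far p' s' hp' hs' hp't h hp's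
  rcases adj_of_not_outer D hrO1 with h | h | h
  · exact inner u v w (by simp) (by simp) (by simp) hvw.ne huv.ne.symm huw.ne.symm h.symm
  · exact inner v u w (by simp) (by simp) (by simp) huw.ne huv.ne hvw.ne.symm h.symm
  · exact inner w u v (by simp) (by simp) (by simp) huv.ne huw.ne hvw.ne h.symm

end C047

end TriangleCap

end PercRepro
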